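import Summits.CriticalPhenomena.PercolationContinuityZ3.Theorems.SoloBlindChainBK
import Summits.CriticalPhenomena.PercolationContinuityZ3.Theorems.SoloBlindSparseFins
import HarnessLib

/-!
# Fins attached along a periodic set of feet, I: the chain structure

Seat `solo-CriticalPhenomena-blind`, toward `PercolationContinuityZ3` via the boundary-rate
technology (`SoloBlindOpenRungs.LineRate`).  Region `S_Z = ℍ ∪ F_Z` of `ℤ³` with
`ℍ = {0 ≤ x₀}` and the fin `F_Z = {x₁ = 0, x₀ ≤ -2} ∪ {(-1, 0, z) : z ∈ Z}` (the geometry of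
`SoloBlindSparseFins`).  With `K = withinGraph ℤ³ S_Z` and `K₀ = withinGraph ℤ³ ℍ ⊔ withinGraph ℤ³ F_Z`
(no interface edges) the pieces of `SoloBlindChainDepth` are one-sided clusters, a.s. all finite at
`p_c` (BGN in half-spaces), and the interface edges are the connector edges
`((0,0,z), (-1,0,z))`, `z ∈ Z`.  Consequently (`exists_adm_mem_disjointOccurrenceList`) an infinite
`K`-cluster of a vertex `x ∈ ℍ` (resp. `F_Z`) forces, for every `n`, the disjoint occurrence of the
chain events of an ALTERNATING chain `mkChain n s f` of connector heights `f : Fin n → Z` with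
consecutive heights distinct.  The summation over `f` is carried out in `SoloBlindPeriodicFin`.
-/

noncomputable section

namespace Summit.CriticalPhenomena.PercolationContinuityZ3.Theorems

open MeasureTheory Literature.Probability.Percolation Literature.Probability.LatticeModels

/-! ### Geometry of `S_Z` -/

/-- The half-space `ℍ = {0 ≤ x₀}`. -/
def hsp : Set (Site 3) := {x : Site 3 | 0 ≤ x 0}

/-- The fin with feet `Z`: `{x₁ = 0, x₀ ≤ -2} ∪ {(-1, 0, z) : z ∈ Z}`. -/
def finZ (Z : Set ℤ) : Set (Site 3) :=
  {x : Site 3 | (x 1 = 0 ∧ x 0 ≤ -2) ∨ (x 1 = 0 ∧ x 0 = -1 ∧ x 2 ∈ Z)}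

/-- The two sides: `true ↦ ℍ`, `false ↦ F_Z`. -/
def sideSet (Z : Set ℤ) : Bool → Set (Site 3)
  | true => hsp
  | false => finZ Z

/-- The step graph of the region `S_Z = ℍ ∪ F_Z`. -/
def KS (Z : Set ℤ) : SimpleGraph (Site 3) := withinGraph (zdGraph 3) (hsp ∪ finZ Z)

/-- The step graph without interface edges. -/
def K0 (Z : Set ℤ) : SimpleGraph (Site 3) :=
  withinGraph (zdGraph 3) hsp ⊔ withinGraph (zdGraph 3) (finZ Z)

/-- The connector `(0,0,z)` (`true`) and its foot `(-1,0,z)` (`false`). -/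
def cpt : Bool → ℤ → Site 3
  | true, z => Function.update (0 : Site 3) 2 z
  | false, z => Function.update (0 : Site 3) 2 z - Pi.single 0 1

/-- The connector edge at height `z`, oriented away from side `s`. -/
def crossE (s : Bool) (z : ℤ) : Site 3 × Site 3 := (cpt s z, cpt (!s) z)

/-- The alternating chain of connector edges with heights `f`, starting from side `s`. -/
def mkChain : (n : ℕ) → Bool → (Fin n → ℤ) → List (Site 3 × Site 3)
  | 0, _, _ => []
  | n + 1, s, f => crossE s (f 0) :: mkChain n (!s) (Fin.tail f)

/-- Admissible height sequences after a visit at height `z`: heights in `Z`, consecutive heights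
distinct. -/
def admSet (Z : Set ℤ) : (n : ℕ) → ℤ → Set (Fin n → ℤ)
  | 0, _ => Set.univ
  | n + 1, z => {f | f 0 ∈ Z ∧ f 0 ≠ z ∧ Fin.tail f ∈ admSet Z n (f 0)}

/-- Admissible height sequences (no initial constraint). -/
def admSet₀ (Z : Set ℤ) : (n : ℕ) → Set (Fin n → ℤ)
  | 0 => Set.univ
  | n + 1 => {f | f 0 ∈ Z ∧ Fin.tail f ∈ admSet Z n (f 0)}

/-- The half-space and the fin are disjoint. -/
theorem disjoint_hsp_finZ (Z : Set ℤ) : Disjoint hsp (finZ Z) := by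
  rw [Set.disjoint_left]
  rintro v (hv : 0 ≤ v 0) (⟨_, h⟩ | ⟨_, h, _⟩) <;> omega

/-- The fin lies in the plane `{x₁ = 0}` to the left of the half-space. -/
theorem finZ_subset (Z : Set ℤ) : finZ Z ⊆ {x : Site 3 | x 0 ≤ -1} := by
  rintro v (⟨_, h⟩ | ⟨_, h, _⟩) <;> simp only [Set.mem_setOf_eq] <;> omega

/-- The piece graph is a subgraph of the step graph. -/
theorem K0_le_KS (Z : Set ℤ) : K0 Z ≤ KS Z :=
  sup_le (withinGraph_mono _ Set.subset_union_left) (withinGraph_mono _ Set.subset_union_right)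

/-- The step graph is a subgraph of `ℤ³`. -/
theorem KS_le (Z : Set ℤ) : KS Z ≤ zdGraph 3 := withinGraph_le _ _

/-- The height coordinate of a connector endpoint. -/
theorem cpt_apply_two (s : Bool) (z : ℤ) : cpt s z 2 = z := by
  cases s <;> simp [cpt]

/-- Connector endpoints on one side are determined by their height. -/
theorem cpt_injective (s : Bool) : Function.Injective (cpt s) := fun z z' h => by
  have := congrArg (fun f : Site 3 => f 2) h
  simpa only [cpt_apply_two] using this

/-- A connector endpoint lies on its side (for admissible heights on the fin side). -/
theorem cpt_mem_sideSet {Z : Set ℤ} (s : Bool) {z : ℤ} (hz : z ∈ Z) : cpt s z ∈ sideSet Z s := by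
  cases s
  · right
    refine ⟨by simp [cpt], by simp [cpt], ?_⟩
    simpa [cpt] using hz
  · show (0 : ℤ) ≤ Function.update (0 : Site 3) 2 z 0
    simp

/-- Half-space connector endpoints lie in the half-space. -/
theorem cpt_true_mem_hsp (z : ℤ) : cpt true z ∈ hsp := by
  show (0 : ℤ) ≤ Function.update (0 : Site 3) 2 z 0
  simp

/-- The origin lies in the half-space. -/
theorem zero_mem_hsp : (0 : Site 3) ∈ hsp := by
  show (0 : ℤ) ≤ (0 : Site 3) 0
  simp

/-- Each side lies in the region. -/
theorem sideSet_subset_union (Z : Set ℤ) (s : Bool) : sideSet Z s ⊆ hsp ∪ finZ Z := by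
  cases s
  · exact Set.subset_union_right
  · exact Set.subset_union_left

/-- `KS` is locally finite. -/
theorem KS_neighborSet_finite (Z : Set ℤ) (u : Site 3) : ((KS Z).neighborSet u).Finite := by
  refine ((zdGraph 3).neighborFinset u).finite_toSet.subset fun v hv => ?_
  rw [SimpleGraph.mem_neighborSet] at hv
  simpa using KS_le Z hv

/-! ### Pieces are one-sided -/

/-- Reachability inside a set closed under the steps of `G` transfers to a smaller graph. -/
theorem reachable_of_closed {V : Type*} {G H : SimpleGraph V} {A : Set V}
    (h : ∀ u w, u ∈ A → G.Adj u w → H.Adj u w ∧ w ∈ A) {v z : V} (hv : v ∈ A)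
    (hr : G.Reachable v z) : H.Reachable v z ∧ z ∈ A := by
  obtain ⟨p⟩ := hr
  induction p with
  | nil => exact ⟨SimpleGraph.Reachable.refl _, hv⟩
  | cons hadj _ ih =>
    obtain ⟨hH, hw⟩ := h _ _ hv hadj
    obtain ⟨hr, hz⟩ := ih hw
    exact ⟨hH.reachable.trans hr, hz⟩

/-- An edge of the step graph from a half-space vertex to a non-fin vertex is a piece edge. -/
theorem K0_adj_of_mem_hsp {Z : Set ℤ} {u w : Site 3} (hu : u ∈ hsp) (h : (K0 Z).Adj u w) :
    (withinGraph (zdGraph 3) hsp).Adj u w := by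
  rcases h with h | h
  · exact h
  · exact absurd hu (Set.disjoint_right.1 (disjoint_hsp_finZ Z) h.2.1)

/-- An edge of the step graph from a fin vertex to a non-half-space vertex is a piece edge. -/
theorem K0_adj_of_mem_finZ {Z : Set ℤ} {u w : Site 3} (hu : u ∈ finZ Z) (h : (K0 Z).Adj u w) :
    (withinGraph (zdGraph 3) (finZ Z)).Adj u w := by
  rcases h with h | h
  · exact absurd hu (Set.disjoint_left.1 (disjoint_hsp_finZ Z) h.2.1)
  · exact h

/-- The piece of a vertex of `ℍ` is contained in its `ℍ`-cluster. -/
theorem piece_subset_of_mem_hsp {Z : Set ℤ} {ω : BondConfig (Site 3)} {v : Site 3} (hv : v ∈ hsp) :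
    openClusterIn (K0 Z) ω v ⊆ openClusterIn (withinGraph (zdGraph 3) hsp) ω v := by
  intro z hz
  rw [mem_openClusterIn_iff] at hz ⊢
  refine (reachable_of_closed (G := openGraph ω ⊓ K0 Z) (A := hsp) ?_ hv hz).1
  intro u w hu hadj
  rw [SimpleGraph.inf_adj] at hadj
  have h' := K0_adj_of_mem_hsp hu hadj.2
  exact ⟨(SimpleGraph.inf_adj _ _ _ _).2 ⟨hadj.1, h'⟩, h'.2.2⟩

/-- The piece of a vertex of the fin is contained in its fin-cluster. -/
theorem piece_subset_of_mem_finZ {Z : Set ℤ} {ω : BondConfig (Site 3)} {v : Site 3}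
    (hv : v ∈ finZ Z) :
    openClusterIn (K0 Z) ω v ⊆ openClusterIn (withinGraph (zdGraph 3) (finZ Z)) ω v := by
  intro z hz
  rw [mem_openClusterIn_iff] at hz ⊢
  refine (reachable_of_closed (G := openGraph ω ⊓ K0 Z) (A := finZ Z) ?_ hv hz).1
  intro u w hu hadj
  rw [SimpleGraph.inf_adj] at hadj
  have h' := K0_adj_of_mem_finZ hu hadj.2
  exact ⟨(SimpleGraph.inf_adj _ _ _ _).2 ⟨hadj.1, h'⟩, h'.2.2⟩

/-- Pieces stay on their side. -/
theorem piece_subset_sideSet {Z : Set ℤ} {ω : BondConfig (Site 3)} (s : Bool) {v : Site 3}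
    (hv : v ∈ sideSet Z s) : openClusterIn (K0 Z) ω v ⊆ sideSet Z s := by
  cases s
  · exact (piece_subset_of_mem_finZ hv).trans (openClusterIn_withinGraph_subset hv _)
  · exact (piece_subset_of_mem_hsp hv).trans (openClusterIn_withinGraph_subset hv _)

/-- The piece of a vertex outside `S_Z` is a singleton. -/
theorem piece_eq_singleton_of_not_mem {Z : Set ℤ} {ω : BondConfig (Site 3)} {v : Site 3}
    (hv : v ∉ hsp ∪ finZ Z) : openClusterIn (K0 Z) ω v = {v} := by
  refine Set.Subset.antisymm (fun z hz => ?_) ?_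
  · rw [mem_openClusterIn_iff] at hz
    have := (reachable_of_closed (G := openGraph ω ⊓ K0 Z) (H := ⊥) (A := (hsp ∪ finZ Z)ᶜ) ?_ hv hz).1
    · exact (SimpleGraph.reachable_bot.1 this).symm
    · intro u w hu hadj
      rw [SimpleGraph.inf_adj] at hadj
      rcases hadj.2 with h | h
      · exact absurd (Or.inl h.2.1) hu
      · exact absurd (Or.inr h.2.1) hu
  · rintro z rfl; exact self_mem_openClusterIn _ _ _

/-- **All pieces are finite, a.s.** (BGN in the half-spaces `{0 ≤ x₀}` and `{x₀ ≤ -1}`). -/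
theorem ae_forall_piece_finite (Z : Set ℤ) :
    ∀ᵐ ω ∂(bondPercolation (zdGraph 3) (criticalProbI 3)), ∀ v, (openClusterIn (K0 Z) ω v).Finite := by
  filter_upwards [RegionGluing.ae_forall_not_percolatesVia_coordHalfSpace] with ω hH v
  by_cases hv : v ∈ hsp ∪ finZ Z
  · rcases hv with hv | hv
    · exact (Set.not_infinite.1 (hH 0 0 v).1).subset (piece_subset_of_mem_hsp hv)
    · refine (Set.not_infinite.1 (hH 0 (-1) v).2).subset ((piece_subset_of_mem_finZ hv).trans ?_)
      exact openClusterIn_mono_graph (withinGraph_mono _ (finZ_subset Z)) ω v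
  · rw [piece_eq_singleton_of_not_mem hv]; exact Set.finite_singleton v

/-! ### Interface edges are connector edges -/

/-- An interface edge leaving side `s` is the connector edge `crossE s z` of some `z ∈ Z`. -/
theorem eq_crossE_of_adj {Z : Set ℤ} {e : Site 3 × Site 3} (s : Bool) (h1 : e.1 ∈ sideSet Z s)
    (hK : (KS Z).Adj e.1 e.2) (hK0 : ¬(K0 Z).Adj e.1 e.2) :
    ∃ z ∈ Z, e = crossE s z := by
  obtain ⟨hadj, hu, hw⟩ := hK
  have hK0' : ¬(e.1 ∈ hsp ∧ e.2 ∈ hsp) ∧ ¬(e.1 ∈ finZ Z ∧ e.2 ∈ finZ Z) := by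
    constructor
    · exact fun h => hK0 (Or.inl ⟨hadj, h.1, h.2⟩)
    · exact fun h => hK0 (Or.inr ⟨hadj, h.1, h.2⟩)
  cases s
  · -- `e.1` in the fin, `e.2` in `ℍ`: apply the cross-edge lemma to the reversed edge
    have h1' : e.1 ∈ finZ Z := h1
    have h2 : e.2 ∈ hsp := by
      rcases hw with hw | hw
      · exact hw
      · exact absurd ⟨h1', hw⟩ hK0'.2
    obtain ⟨hz, hA, hB⟩ := sparseFin_crossEdge_eq (Z := Z) (e := (e.2, e.1)) ⟨h2, h1', hadj.symm⟩
    refine ⟨e.1 2, hz, Prod.ext hB hA⟩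
  · have h1' : e.1 ∈ hsp := h1
    have h2 : e.2 ∈ finZ Z := by
      rcases hw with hw | hw
      · exact absurd ⟨h1', hw⟩ hK0'.1
      · exact hw
    obtain ⟨hz, hA, hB⟩ := sparseFin_crossEdge_eq (Z := Z) (e := e) ⟨h1', h2, hadj⟩
    exact ⟨e.2 2, hz, Prod.ext hA hB⟩

/-- The near endpoint of a connector. -/
@[simp] theorem crossE_fst (s : Bool) (z : ℤ) : (crossE s z).1 = cpt s z := rfl
/-- The far endpoint of a connector. -/
@[simp] theorem crossE_snd (s : Bool) (z : ℤ) : (crossE s z).2 = cpt (!s) z := rfl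
/-- The empty height sequence gives the empty chain. -/
@[simp] theorem mkChain_zero (s : Bool) (f : Fin 0 → ℤ) : mkChain 0 s f = [] := rfl
/-- The chain of a height sequence, unfolded. -/
@[simp] theorem mkChain_succ (n : ℕ) (s : Bool) (f : Fin (n + 1) → ℤ) :
    mkChain (n + 1) s f = crossE s (f 0) :: mkChain n (!s) (Fin.tail f) := rfl
/-- The chain of a height sequence of length `n` has length `n`. -/
@[simp] theorem mkChain_length : ∀ (n : ℕ) (s : Bool) (f : Fin n → ℤ), (mkChain n s f).length = n
  | 0, _, _ => rfl
  | n + 1, s, f => by rw [mkChain_succ, List.length_cons, mkChain_length]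
/-- Every empty sequence is admissible. -/
@[simp] theorem mem_admSet_zero (Z : Set ℤ) (z : ℤ) (f : Fin 0 → ℤ) : f ∈ admSet Z 0 z := trivial
/-- Admissibility of a height sequence, unfolded. -/
@[simp] theorem mem_admSet_succ (Z : Set ℤ) (n : ℕ) (z : ℤ) (f : Fin (n + 1) → ℤ) :
    f ∈ admSet Z (n + 1) z ↔ f 0 ∈ Z ∧ f 0 ≠ z ∧ Fin.tail f ∈ admSet Z n (f 0) := Iff.rfl
/-- Every empty sequence is start-admissible. -/
@[simp] theorem mem_admSet₀_zero (Z : Set ℤ) (f : Fin 0 → ℤ) : f ∈ admSet₀ Z 0 := trivial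
/-- Start-admissibility of a height sequence, unfolded. -/
@[simp] theorem mem_admSet₀_succ (Z : Set ℤ) (n : ℕ) (f : Fin (n + 1) → ℤ) :
    f ∈ admSet₀ Z (n + 1) ↔ f 0 ∈ Z ∧ Fin.tail f ∈ admSet Z n (f 0) := Iff.rfl

/-! ### Exact chains in `S_Z` are alternating connector chains -/

/-- **Structure of exact chains in `S_Z`.** An exact chain from a vertex `a` on side `s` is the
alternating connector chain `mkChain n s f` of a height sequence `f` in `Z`. -/
theorem exactChain_eq_mkChain {Z : Set ℤ} {ω : BondConfig (Site 3)} {x : Site 3} :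
    ∀ (l : List (Site 3 × Site 3)) {k : ℕ} {a y : Site 3} (s : Bool), a ∈ sideSet Z s →
    a ∈ depthLayer (K0 Z) (KS Z) ω x k → ω ∈ exactChain (K0 Z) (KS Z) x k a l y →
    ∃ f : Fin l.length → ℤ, (∀ i, f i ∈ Z) ∧ l = mkChain l.length s f
  | [], k, a, y, s, _, _, _ => ⟨Fin.elim0, fun i => i.elim0, rfl⟩
  | e :: l, k, a, y, s, ha, hak, hc => by
    obtain ⟨h1, ⟨hK, hω⟩, h3, h4⟩ := mem_exactChain_cons.1 hc
    have hK0 : ¬(K0 Z).Adj e.1 e.2 := not_adj_of_exactChain hak hc e (by simp)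
    obtain ⟨z, hz, rfl⟩ := eq_crossE_of_adj s (piece_subset_sideSet s ha h1) hK hK0
    have h2side : (crossE s z).2 ∈ sideSet Z (!s) := by
      rw [crossE_snd]; exact cpt_mem_sideSet (!s) hz
    obtain ⟨f, hfZ, hl⟩ := exactChain_eq_mkChain l (!s) h2side h3 h4
    refine ⟨Fin.cons z f, fun i => Fin.cases hz hfZ i, ?_⟩
    simp only [List.length_cons, mkChain_succ, Fin.cons_zero, Fin.tail_cons]
    rw [← hl]

/-- Consecutive distinctness of an alternating chain, read off as admissibility (with a
previous visit at height `z₀`). -/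
theorem mem_admSet_of_isChain {Z : Set ℤ} : ∀ (n : ℕ) (s : Bool) (f : Fin n → ℤ) (z₀ : ℤ),
    (∀ i, f i ∈ Z) → (crossE (!s) z₀ :: mkChain n s f).IsChain (fun e e' => e'.2 ≠ e.1) →
    f ∈ admSet Z n z₀
  | 0, _, _, _, _, _ => trivial
  | n + 1, s, f, z₀, hfZ, hch => by
    rw [mkChain_succ, List.isChain_cons_cons] at hch
    obtain ⟨hne, hch⟩ := hch
    refine ⟨hfZ 0, fun h => hne ?_, mem_admSet_of_isChain n (!s) (Fin.tail f) (f 0) (fun i => hfZ _) ?_⟩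
    · rw [crossE_snd, crossE_fst, h]
    · simpa only [Bool.not_not] using hch

/-- Consecutive distinctness of an alternating chain, read off as admissibility. -/
theorem mem_admSet₀_of_isChain {Z : Set ℤ} : ∀ (n : ℕ) (s : Bool) (f : Fin n → ℤ),
    (∀ i, f i ∈ Z) → (mkChain n s f).IsChain (fun e e' => e'.2 ≠ e.1) → f ∈ admSet₀ Z n
  | 0, _, _, _, _ => trivial
  | n + 1, s, f, hfZ, hch => by
    rw [mkChain_succ] at hch
    refine ⟨hfZ 0, mem_admSet_of_isChain n (!s) (Fin.tail f) (f 0) (fun i => hfZ _) ?_⟩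
    simpa only [Bool.not_not] using hch

/-- **Infinite clusters in `S_Z` force admissible alternating chains of every length.** If all
pieces of `ω` are finite and the `K`-cluster of `x ∈ sideSet Z s` is infinite, then for every `n`
some admissible `f : Fin n → ℤ` has all its chain events occurring disjointly. -/
theorem exists_adm_mem_disjointOccurrenceList {Z : Set ℤ} {ω : BondConfig (Site 3)} {x : Site 3}
    (s : Bool) (hx : x ∈ sideSet Z s) (hfin : ∀ v, (openClusterIn (K0 Z) ω v).Finite)
    (hperc : ω ∈ percolatesVia (KS Z) x) (n : ℕ) :
    ∃ f : Fin n → ℤ, f ∈ admSet₀ Z n ∧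
      ω ∈ disjointOccurrenceList (chainEvents (K0 Z) x (mkChain n s f)) := by
  obtain ⟨l, y, hl, hc, hD⟩ :=
    exists_exactChain_mem_disjointOccurrenceList hfin (KS_neighborSet_finite Z) hperc n
  subst hl
  obtain ⟨f, hfZ, hlf⟩ := exactChain_eq_mkChain l s hx mem_depthLayer_zero hc
  have hch := exactChain_isChain_ne mem_depthLayer_zero hc
  rw [hlf] at hch hD
  exact ⟨f, mem_admSet₀_of_isChain _ s f hfZ (by simpa using hch), by simpa using hD⟩

end Summit.CriticalPhenomena.PercolationContinuityZ3.Theorems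

end
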